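import Summits.Ventures.Crystal3D.Theorems.StickyWulffConstantCoaxialWallLawFluxGap
import Summits.Ventures.Crystal3D.Theorems.StickyWulffConstantCoaxialWallLawTerracePropagation
import Summits.Ventures.Crystal3D.Theorems.StickyWulffConstantGenericWallFloorMixedDozenRules
import HarnessLib

/-!
# A coherent twin dozen determines its composition plane (injectivity lemmas for the v2 line automaton)

HONEST FRAMING. Part of the venture `Summits/Ventures/Crystal3D` (cell `crystal3d-full`), helper for the
crux `CoaxialWallLaw` (stmt-Ventures-19481) of `route-Ventures-StickyWulffConstant`, REGISTERED line
`WallLedgerF` (planner cf-p1 gen 16), open stub `stub_coaxialTwoSlabAdhesion` (general fillings).  Brick E of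
the v2 (NET) line automaton (memo F-NET-AUTOMATON-v2, evidence on the crux item): injectivity of the word
automaton reduces to two local facts about a ball `b` read as a coherent twin dozen of a frame `G` across the
`{111}` plane with unit normal `m` (own closed lower half-dozen `{b + G w : ⟪G w, m⟫ ≤ 0} ⊆ X`, mirror images
`b + G w − 2⟪G w, m⟫ m` of the negative slots in `X`):

* `twinDozen_mirror_pos_notMem` — the mirror image of a POSITIVE slot is absent: it lies at distance `1/√3`
  from an own negative neighbour (so the straight-line predecessor of a crossing target is never a state);
* `twinDozen_normal_eq` — if `b` reads as a twin dozen of `(G₁, m₁)` and of `(G₂, m₂)` with the SAME mirror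
  frame `F'` (`F' = G₁ − 2⟪G₁·, m₁⟫ m₁ = G₂ − 2⟪G₂·, m₂⟫ m₂` pointwise), then `m₁ = m₂`: the negative-`m₁`
  slots of `F'` are absent, the non-negative-`m₂` slots of `F'` are present, so the negative triples coincide
  and `Σ ⟪F' vⱼ, m₂⟫ = −√6 ⟪m₁, m₂⟫` (`sum_far_inner`) forces `⟪m₁, m₂⟫ = 1`.  Hence two different letters never
  lead into the same class at the same ball.

Only `1`-separation of `X` is used (no kissing facts).  WHAT THIS IS NOT: not the stub; F-C1 not moved.
-/

noncomputable section

namespace Summit.Ventures.Crystal3D.Theorems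

open Summit.Ventures.Crystal3D Finset
open Literature.MathematicalPhysics.StatisticalMechanics (fccStacking)
open scoped InnerProductSpace

variable {X : Finset (EuclideanSpace ℝ (Fin 3))}

/-- **The mirror of a positive slot is empty at a twin dozen.**  See the module docstring. -/
theorem twinDozen_mirror_pos_notMem (hX : ∀ p ∈ X, ∀ q ∈ X, p ≠ q → 1 ≤ dist p q)
    (G : EuclideanSpace ℝ (Fin 3) ≃ₗᵢ[ℝ] EuclideanSpace ℝ (Fin 3)) {m : EuclideanSpace ℝ (Fin 3)} (hm : ‖m‖ = 1)
    (hmenu : ∀ w ∈ fccSlots, ⟪G w, m⟫_ℝ = 0 ∨ ⟪G w, m⟫_ℝ = Real.sqrt (2 / 3) ∨ ⟪G w, m⟫_ℝ = -Real.sqrt (2 / 3))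
    {b : EuclideanSpace ℝ (Fin 3)} (hown : ∀ w ∈ fccSlots, ⟪G w, m⟫_ℝ ≤ 0 → b + G w ∈ X)
    {u : EuclideanSpace ℝ (Fin 3)} (hu : u ∈ fccSlots) (hpos : 0 < ⟪G u, m⟫_ℝ) :
    b + (G u - (2 * ⟪G u, m⟫_ℝ) • m) ∉ X := by
  intro hp
  have h23 : Real.sqrt (2 / 3) ^ 2 = 2 / 3 := Real.sq_sqrt (by norm_num)
  have hr : 0 < Real.sqrt (2 / 3) := Real.sqrt_pos.2 (by norm_num)
  have hun : ⟪G u, m⟫_ℝ = Real.sqrt (2 / 3) := by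
    rcases hmenu u hu with h | h | h
    · rw [h] at hpos; exact absurd hpos (lt_irrefl 0)
    · exact h
    · rw [h] at hpos; linarith
  -- a second positive slot `u'` at `60°` from `u`
  obtain ⟨u₁, hu₁, u₂, hu₂, u₃, hu₃, hn₁, hn₂, hn₃, i12, i13, -, -, hcover⟩ := exists_far_frame G hm hmenu
  obtain ⟨u', hu', hn', i'⟩ : ∃ u' ∈ fccSlots, ⟪G u', m⟫_ℝ = Real.sqrt (2 / 3) ∧ ⟪u, u'⟫_ℝ = 1 / 2 := by
    rcases hcover u hu hpos with rfl | rfl | rfl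
    · exact ⟨u₂, hu₂, hn₂, i12⟩
    · exact ⟨u₁, hu₁, hn₁, by rw [real_inner_comm]; exact i12⟩
    · exact ⟨u₁, hu₁, hn₁, by rw [real_inner_comm]; exact i13⟩
  -- the own negative neighbour `b − G u'` is present
  have hq : b + G (-u') ∈ X :=
    hown (-u') (neg_mem_fccSlots hu') (by rw [map_neg, inner_neg_left, hn']; linarith)
  -- distance `1/√3`
  have a11 : ⟪G u, G u⟫_ℝ = 1 := by
    rw [real_inner_self_eq_norm_sq, LinearIsometryEquiv.norm_map, norm_eq_one_of_mem_fccSlots hu, one_pow]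
  have a22 : ⟪G u', G u'⟫_ℝ = 1 := by
    rw [real_inner_self_eq_norm_sq, LinearIsometryEquiv.norm_map, norm_eq_one_of_mem_fccSlots hu', one_pow]
  have a12 : ⟪G u, G u'⟫_ℝ = 1 / 2 := by rw [LinearIsometryEquiv.inner_map_map, i']
  have a21 : ⟪G u', G u⟫_ℝ = 1 / 2 := by rw [real_inner_comm]; exact a12
  have mm : ⟪m, m⟫_ℝ = 1 := by rw [real_inner_self_eq_norm_sq, hm, one_pow]
  have m1 : ⟪m, G u⟫_ℝ = Real.sqrt (2 / 3) := by rw [real_inner_comm]; exact hun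
  have m2 : ⟪m, G u'⟫_ℝ = Real.sqrt (2 / 3) := by rw [real_inner_comm]; exact hn'
  have hd2 : dist (b + (G u - (2 * ⟪G u, m⟫_ℝ) • m)) (b + G (-u')) ^ 2 = 1 / 3 := by
    rw [dist_eq_norm, add_sub_add_left_eq_sub, map_neg, hun, ← real_inner_self_eq_norm_sq]
    have e : G u - (2 * Real.sqrt (2 / 3)) • m - -G u' = G u + G u' - (2 * Real.sqrt (2 / 3)) • m := by abel
    rw [e]
    simp only [inner_sub_left, inner_sub_right, inner_add_left, inner_add_right, real_inner_smul_left,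
      real_inner_smul_right, a11, a22, a12, a21, hun, hn', mm, m1, m2]
    nlinarith [h23]
  have hne : b + (G u - (2 * ⟪G u, m⟫_ℝ) • m) ≠ b + G (-u') := by
    intro h
    rw [h, dist_self] at hd2
    norm_num at hd2
  have h1 := hX _ hp _ hq hne
  nlinarith [h1, hd2, dist_nonneg (x := b + (G u - (2 * ⟪G u, m⟫_ℝ) • m)) (y := b + G (-u'))]

/-- **A twin dozen determines its composition plane.**  See the module docstring. -/
theorem twinDozen_normal_eq (hX : ∀ p ∈ X, ∀ q ∈ X, p ≠ q → 1 ≤ dist p q)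
    (F' G₁ G₂ : EuclideanSpace ℝ (Fin 3) ≃ₗᵢ[ℝ] EuclideanSpace ℝ (Fin 3)) {m₁ m₂ : EuclideanSpace ℝ (Fin 3)}
    (hm₁ : ‖m₁‖ = 1) (hm₂ : ‖m₂‖ = 1)
    (hmenu₁ : ∀ w ∈ fccSlots,
      ⟪G₁ w, m₁⟫_ℝ = 0 ∨ ⟪G₁ w, m₁⟫_ℝ = Real.sqrt (2 / 3) ∨ ⟪G₁ w, m₁⟫_ℝ = -Real.sqrt (2 / 3))
    (hmenu₂ : ∀ w ∈ fccSlots,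
      ⟪G₂ w, m₂⟫_ℝ = 0 ∨ ⟪G₂ w, m₂⟫_ℝ = Real.sqrt (2 / 3) ∨ ⟪G₂ w, m₂⟫_ℝ = -Real.sqrt (2 / 3))
    (hG₁ : ∀ x, F' x = G₁ x - (2 * ⟪G₁ x, m₁⟫_ℝ) • m₁) (hG₂ : ∀ x, F' x = G₂ x - (2 * ⟪G₂ x, m₂⟫_ℝ) • m₂)
    {b : EuclideanSpace ℝ (Fin 3)}
    (hown₁ : ∀ w ∈ fccSlots, ⟪G₁ w, m₁⟫_ℝ ≤ 0 → b + G₁ w ∈ X)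
    (hown₂ : ∀ w ∈ fccSlots, ⟪G₂ w, m₂⟫_ℝ ≤ 0 → b + G₂ w ∈ X)
    (hmir₂ : ∀ w ∈ fccSlots, ⟪G₂ w, m₂⟫_ℝ < 0 → b + (G₂ w - (2 * ⟪G₂ w, m₂⟫_ℝ) • m₂) ∈ X) :
    m₁ = m₂ := by
  have hr : 0 < Real.sqrt (2 / 3) := Real.sqrt_pos.2 (by norm_num)
  have h6 : 0 < Real.sqrt 6 := Real.sqrt_pos.2 (by norm_num)
  -- inner products of `F'`-slots with the two normals, from the two readings
  have hF₁ : ∀ x, ⟪F' x, m₁⟫_ℝ = -⟪G₁ x, m₁⟫_ℝ := by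
    intro x
    rw [hG₁, inner_sub_left, real_inner_smul_left, real_inner_self_eq_norm_sq, hm₁]; ring
  have hF₂ : ∀ x, ⟪F' x, m₂⟫_ℝ = -⟪G₂ x, m₂⟫_ℝ := by
    intro x
    rw [hG₂, inner_sub_left, real_inner_smul_left, real_inner_self_eq_norm_sq, hm₂]; ring
  -- (i) the negative-`m₁` slots of `F'` are absent
  have habs : ∀ v ∈ fccSlots, ⟪F' v, m₁⟫_ℝ < 0 → b + F' v ∉ X := by
    intro v hv hneg
    have hpos : 0 < ⟪G₁ v, m₁⟫_ℝ := by rw [hF₁] at hneg; linarith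
    rw [hG₁]
    exact twinDozen_mirror_pos_notMem hX G₁ hm₁ hmenu₁ hown₁ hv hpos
  -- (ii) the non-negative-`m₂` slots of `F'` are present
  have hpres : ∀ v ∈ fccSlots, 0 ≤ ⟪F' v, m₂⟫_ℝ → b + F' v ∈ X := by
    intro v hv hnn
    have hle : ⟪G₂ v, m₂⟫_ℝ ≤ 0 := by rw [hF₂] at hnn; linarith
    rcases hle.lt_or_eq with hlt | heq
    · rw [hG₂]; exact hmir₂ v hv hlt
    · have : F' v = G₂ v := by rw [hG₂, heq, mul_zero, zero_smul, sub_zero]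
      rw [this]; exact hown₂ v hv hle
  -- the menu of `F'` for `−m₁` and for `m₂`
  have hmenu₁' : ∀ w ∈ fccSlots,
      ⟪F' w, -m₁⟫_ℝ = 0 ∨ ⟪F' w, -m₁⟫_ℝ = Real.sqrt (2 / 3) ∨ ⟪F' w, -m₁⟫_ℝ = -Real.sqrt (2 / 3) := by
    intro w hw
    rw [inner_neg_right, hF₁, neg_neg]
    exact hmenu₁ w hw
  have hmenu₂' : ∀ w ∈ fccSlots,
      ⟪F' w, m₂⟫_ℝ = 0 ∨ ⟪F' w, m₂⟫_ℝ = Real.sqrt (2 / 3) ∨ ⟪F' w, m₂⟫_ℝ = -Real.sqrt (2 / 3) := by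
    intro w hw
    rw [hF₂]
    rcases hmenu₂ w hw with h | h | h
    · exact Or.inl (by rw [h, neg_zero])
    · exact Or.inr (Or.inr (by rw [h]))
    · exact Or.inr (Or.inl (by rw [h, neg_neg]))
  -- (iii) the far triple of `(F', −m₁)` consists of negative-`m₂` slots
  have hm₁' : ‖-m₁‖ = 1 := by rw [norm_neg, hm₁]
  obtain ⟨v₁, hv₁, v₂, hv₂, v₃, hv₃, hn₁, hn₂, hn₃, i12, i13, i23, -, -⟩ := exists_far_frame F' hm₁' hmenu₁'
  have hneg : ∀ v ∈ fccSlots, ⟪F' v, -m₁⟫_ℝ = Real.sqrt (2 / 3) → ⟪F' v, m₂⟫_ℝ = -Real.sqrt (2 / 3) := by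
    intro v hv h
    have h1 : ⟪F' v, m₁⟫_ℝ < 0 := by rw [inner_neg_right] at h; linarith
    rcases hmenu₂' v hv with h2 | h2 | h2
    · exact absurd (hpres v hv h2.symm.le) (habs v hv h1)
    · exact absurd (hpres v hv (by rw [h2]; exact hr.le)) (habs v hv h1)
    · exact h2
  have hsum := sum_far_inner F' hm₁' hv₁ hv₂ hv₃ hn₁ hn₂ hn₃ i12 i13 i23 m₂
  rw [hneg v₁ hv₁ hn₁, hneg v₂ hv₂ hn₂, hneg v₃ hv₃ hn₃, inner_neg_left] at hsum
  -- `−3√(2/3) = −√6 ⟪m₁, m₂⟫`, so `⟪m₁, m₂⟫ = 1`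
  have hs6 : Real.sqrt 6 = 3 * Real.sqrt (2 / 3) := by
    rw [show (6 : ℝ) = 3 ^ 2 * (2 / 3) by norm_num, Real.sqrt_mul (by norm_num), Real.sqrt_sq (by norm_num)]
  have hinner : ⟪m₁, m₂⟫_ℝ = 1 := by
    rw [hs6] at hsum
    have : 3 * Real.sqrt (2 / 3) * (⟪m₁, m₂⟫_ℝ - 1) = 0 := by linarith
    rcases mul_eq_zero.1 this with h | h
    · linarith
    · linarith
  exact (inner_eq_one_iff_of_norm_eq_one (𝕜 := ℝ) hm₁ hm₂).1 hinner

end Summit.Ventures.Crystal3D.Theorems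

end
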